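import Summits.RiemannHypothesis.RiemannHypothesis.Theorems.SignConeConeMagnificationPrimeCaratheodory
import Summits.RiemannHypothesis.RiemannHypothesis.Theorems.SignConeConeMagnificationTorusPoisson

/-!
# `SignCone.ConeMagnification`, line `Sketch`: two-sided prime discrepancy of finitely supported admissible weights
(crux stmt-RiemannHypothesis-16303; HELPER file, `--supports`; registered sub-goal `primeDiscrepancy_le_one_of_eventually_vonMangoldt`)

For a weight `c ≥ 0`, `c 1 = 0`, with `c − Λ` FINITELY SUPPORTED and Carathéodory-admissible (the hypotheses of the line's
open core in their registered Poisson form; `𝒜(s) = ½Re ψ(s/2)` by the bridge `poissonArch_eq_half_re_digamma`):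

  `Σ_{p ∈ S} |c(p) − Λ(p)| / √p ≤ 1`   for every finite set `S` of primes,

i.e. the prime discrepancy is `ℓ¹(1/√p)` with norm `≤ 1` — the DEFICIT `Σ_p (log p − c(p))₊/√p ≤ 1` (sharper than the `≤ 2` of
the torus/Fejér route `stub_deficitOfTorus ∘ torusOfCara_of_eventually_vonMangoldt`) AND the SURPLUS at primes `≤ 1`.
Proof: `Re P(1/2+it) ≤ 1/2` for the Dirichlet polynomial `P` of `c − Λ` (`re_dirichletPoly_critical_le_half`, part I of the
finite case) and the Carathéodory–Kronecker bound `sum_prime_abs_div_sqrt_le_one` (`…PrimeCaratheodory.lean`).  This is the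
finite-support endgame of the crux idea card `polydisc-caratheodory-deficit` as a theorem; its open analytic debt (ALIGN) is the
same drift-free transfer to the torus that the open core needs in the non-`ℓ¹` regime.
-/

noncomputable section

-- `Summit.RiemannHypothesis.RiemannHypothesis.…` repeats a namespace component by design (D-0017 layout).
set_option linter.dupNamespace false

open scoped BigOperators
open Complex Finset

namespace Summit.RiemannHypothesis.RiemannHypothesis.Theorems.SignConeConeMagnification

open ArithmeticFunction

/-- **Two-sided prime discrepancy `≤ 1` for finitely supported Carathéodory-admissible weights** (registered Poisson-form
hypotheses of `stub_torusOfCara` + `∃ N, ∀ n ≥ N, c n = Λ n`). [folklore] -/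
theorem primeDiscrepancy_le_one_of_eventually_vonMangoldt :
    ∀ c : ℕ → ℝ, (∀ n, 0 ≤ c n) → c 1 = 0 → (∀ σ : ℝ, 1 < σ → LSeriesSummable (fun n => ((c n : ℝ) : ℂ)) σ)
        → (∃ N : ℕ, ∀ n : ℕ, N ≤ n → c n = ArithmeticFunction.vonMangoldt n) → (∃ F : ℂ → ℂ,
        DifferentiableOn ℂ F {s : ℂ | 1 / 2 < s.re} ∧ (∀ s : ℂ, 1 < s.re → F s = LSeries (fun n => ((c n :
        ℝ) : ℂ)) s - 1 / (s - 1)) ∧ ∀ s : ℂ, 1 / 2 < s.re → (F s).re ≤ 1 / 2 + (1 / s).re + 1 / (2 *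
        Real.pi) * (∫ v : ℝ, (Complex.digamma (1 / 4 + v / 2 * Complex.I)).re * ((s.re - 1 / 2) / ((s.re -
        1 / 2) ^ 2 + (s.im - v) ^ 2))) - Real.log Real.pi / 2) → ∀ S : Finset ℕ, (∀ p ∈ S, p.Prime) → ∑ p ∈
        S, |c p - ArithmeticFunction.vonMangoldt p| / Real.sqrt p ≤ 1 := by
  intro c _ hc1 hsum hev hF S hS
  obtain ⟨N, hN⟩ := hev
  have hF3 := (exists_caraPoisson_iff c).1 hF
  classical
  -- a window containing the support and `S`
  set N' : ℕ := N + S.sup id + 1 with hN'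
  have hNN : ∀ n, N' ≤ n → c n = Λ n := fun n hn => hN n (by omega)
  have hline := re_dirichletPoly_critical_le_half c N' hNN hsum hF3
  -- cosine form on the line
  have hcos : ∀ t : ℝ, ∑ n ∈ Finset.Ico 1 N', (c n - Λ n) / Real.sqrt n * Real.cos (Real.log n * t) ≤ 1 / 2 := by
    intro t
    have ht := hline t
    rw [Complex.re_sum] at ht
    calc ∑ n ∈ Finset.Ico 1 N', (c n - Λ n) / Real.sqrt n * Real.cos (Real.log n * t)
        = ∑ n ∈ Finset.Ico 1 N', ((((c n - Λ n : ℝ)) : ℂ) / (n : ℂ) ^ ((1 / 2 : ℂ) + t * I)).re := by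
          refine Finset.sum_congr rfl fun n hn => ?_
          rw [re_ofReal_div_natCast_cpow_half_add _ _ (Finset.mem_Ico.mp hn).1]
      _ ≤ 1 / 2 := ht
  -- the Carathéodory–Kronecker bound on the window
  have ha1 : c 1 - Λ 1 = 0 := by rw [hc1, vonMangoldt_apply_one, sub_zero]
  have hwin := sum_prime_abs_div_sqrt_le_one (fun n => c n - Λ n) N' ha1 hcos
  -- restrict to `S ⊆ primes < N'`
  have hsub : S ⊆ (Finset.Ico 1 N').filter Nat.Prime := by
    intro p hp
    have hpp := hS p hp
    have hle : p ≤ S.sup id := Finset.le_sup (f := id) hp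
    refine Finset.mem_filter.mpr ⟨Finset.mem_Ico.mpr ⟨hpp.one_lt.le, by omega⟩, hpp⟩
  calc ∑ p ∈ S, |c p - Λ p| / Real.sqrt p
      ≤ ∑ p ∈ (Finset.Ico 1 N').filter Nat.Prime, |c p - Λ p| / Real.sqrt p :=
        Finset.sum_le_sum_of_subset_of_nonneg hsub fun p _ _ => by positivity
    _ ≤ 1 := hwin

/-- **Corollary: the DEFICIT bound with constant `1`** for finitely supported admissible weights:
`Σ_{p∈S} (Λ(p) − c(p))₊/√p ≤ 1` (cf. `≤ 2` via `stub_deficitOfTorus`). [folklore] -/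
theorem primeDeficit_le_one_of_eventually_vonMangoldt :
    ∀ c : ℕ → ℝ, (∀ n, 0 ≤ c n) → c 1 = 0 → (∀ σ : ℝ, 1 < σ → LSeriesSummable (fun n => ((c n : ℝ) : ℂ)) σ)
        → (∃ N : ℕ, ∀ n : ℕ, N ≤ n → c n = ArithmeticFunction.vonMangoldt n) → (∃ F : ℂ → ℂ,
        DifferentiableOn ℂ F {s : ℂ | 1 / 2 < s.re} ∧ (∀ s : ℂ, 1 < s.re → F s = LSeries (fun n => ((c n :
        ℝ) : ℂ)) s - 1 / (s - 1)) ∧ ∀ s : ℂ, 1 / 2 < s.re → (F s).re ≤ 1 / 2 + (1 / s).re + 1 / (2 *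
        Real.pi) * (∫ v : ℝ, (Complex.digamma (1 / 4 + v / 2 * Complex.I)).re * ((s.re - 1 / 2) / ((s.re -
        1 / 2) ^ 2 + (s.im - v) ^ 2))) - Real.log Real.pi / 2) → ∀ S : Finset ℕ, (∀ p ∈ S, p.Prime) → ∑ p ∈
        S, max (ArithmeticFunction.vonMangoldt p - c p) 0 / Real.sqrt p ≤ 1 := by
  intro c hc0 hc1 hsum hev hF S hS
  have h := primeDiscrepancy_le_one_of_eventually_vonMangoldt c hc0 hc1 hsum hev hF S hS
  refine le_trans (Finset.sum_le_sum fun p _ => ?_) h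
  refine div_le_div_of_nonneg_right ?_ (Real.sqrt_nonneg _)
  rw [abs_sub_comm]
  exact max_le (le_abs_self _) (abs_nonneg _)

end Summit.RiemannHypothesis.RiemannHypothesis.Theorems.SignConeConeMagnification

end
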